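import Summits.QuantumFields.YangMills.Theorems.LuscherReductionRunningReductionTraceFormula
import HarnessLib

/-!
# Registered stub `stub_traceFormula : Stmt.stub_traceFormula` of skeleton «KTR» rev 8 (crux RED `RunningReduction`,
# stmt-QuantumFields-19978) — BY NAME AND SIGNATURE, unconditional

Route `LuscherReduction` (rung R2b1), crux RED `RunningReduction` (stmt-QuantumFields-19978), registered skeleton «KTR» rev 8
(`pub/ym-beyond/p1-g19-files/Lines-KTR-r8.lean`, sha16 4d4e029b06d8e70b, `ledger skeleton check` 2026-08-27T07:22:32Z), TT door
PART 5 §3: the stub `stub_traceFormula : Stmt.stub_traceFormula` with `abbrev Stmt.stub_traceFormula : Prop := TraceFormula`,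
`TraceFormula` the skeleton's §2 text over the TREE objects of `Theorems/LuscherReductionRunningReductionTraceFormulaDefs.lean`
(the skeleton `export`s `TT.physTrace`, so its text is literally over tree constants).

The gate credits a stub landing only for the VERBATIM header `theorem stub_traceFormula : Stmt.stub_traceFormula := …`
(docs/reference/gate.md A8: last name component = stub name, statement text = registered signature), and the skeleton (a pub
file) is not importable from `Theorems/`.  This module therefore re-homes the statement abbreviation with the skeleton's §2 text
CHARACTER FOR CHARACTER under the Theorems-side namespace `…Theorems.FemtoTransferGap.TT` (it cannot collide with the skeleton's
`…Cruxes.RunningReduction.TT.Stmt.*`; the two are syntactically identical under the same `open`s, hence interchangeable by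
`Iff.rfl`) and proves it with no hypothesis, route-independently (no `Theses` module in the import cone):

  `stub_traceFormula := TT.traceFormula_all`

— ym-infvol-p1 g3's closed form (`Theorems/LuscherReductionRunningReductionTraceFormula.lean`, p510667: the Hilbert–Schmidt trace of
the zero-flux compression `P K_β P` as a closed kernel chain), whose statement is this very text; the CLOSED route child
`Theses.LuscherReduction.TraceFormula` (support item stmt-QuantumFields-20202, `TT.traceFormula_proof`) is the same text fully
qualified (owner's split note, route rev 11/12: «children rfl-equal to the skeleton stub statements»).  Owner's discharge in the
skeleton: `theorem stub_traceFormula : Stmt.stub_traceFormula :=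
Summit.QuantumFields.YangMills.Theorems.FemtoTransferGap.TT.stub_traceFormula`.

`Stmt.stub_traceFormula` is a statement abbreviation WITH a kernel-closed witness in this very module (audit class
`proved-helper`), not a named fact: nothing under `Theorems/` takes it as a hypothesis.

HONEST FRAMING: fixed-lattice spectral bookkeeping (any `L`, `β ≥ 1`, `T ≥ 2`) on the femto rung R2b1 of the CONDITIONAL Lüscher
reduction route; closes ONE of seven registered stubs of RED's skeleton by name; proves nothing of the RG statements
(`TwistedTraceScaling`, `DressedRitz`, `CoarseHandoverUpper 2`, `ExplicitNoIntruder`), nothing about infinite volume, the continuum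
limit, a mass gap or Clay.  Sorry-free, no new objects, no named-fact hypotheses.
-/

set_option autoImplicit false

noncomputable section

namespace Summit.QuantumFields.YangMills.Theorems.FemtoTransferGap.TT

open Summit.QuantumFields.YangMills.Theorems.FemtoTransferGap

/-- Stub statement (M, spectral layer at fixed lattice) — VERBATIM `TT.Stmt.stub_traceFormula := TraceFormula` of skeleton «KTR»
rev 8 (sha16 4d4e029b06d8e70b), with the skeleton's §2 text of `TraceFormula` inlined over the tree objects `levelValue`, `su2Rep`,
`TT.physTrace`: for `β ≥ 1` and every `T ≥ 2` the zero-flux min–max values `λ_k(L,β)` have `Σ_k λ_k^T = Z_phys(L, β, T)` (as a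
`HasSum`).  Syntactically identical to the closed route child `Theses.LuscherReduction.TraceFormula` (stmt-QuantumFields-20202).
Deliberately WITHOUT a citation tag (a re-homed skeleton statement text over Summits-side objects; the proof below carries the
citations). -/
abbrev Stmt.stub_traceFormula : Prop :=
  ∀ (L : ℕ) [NeZero L] (β : ℝ) (T : ℕ), 1 ≤ β → 2 ≤ T →
    HasSum (fun k : ℕ => levelValue su2Rep L β k ^ T) (physTrace L β T)

/-- ★ **Registered stub `stub_traceFormula` of skeleton «KTR» rev 8 (crux RED, stmt-QuantumFields-19978), BY NAME, unconditional**: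
the trace formula `Σ_k λ_k(L,β)^T = Z_phys(L,β,T)` (`β ≥ 1`, `T ≥ 2`) for the zero-flux compression of the SU(2) transfer operator on
the `L³` femto torus — `TT.traceFormula_all` (p510667; = the closed route child `TraceFormula`, stmt-QuantumFields-20202).
[cite: ReedSimonIV1978, Thm. XIII.1] [cite: MontvayMunster1994, (3.145)] -/
theorem stub_traceFormula : Stmt.stub_traceFormula :=
  traceFormula_all

end Summit.QuantumFields.YangMills.Theorems.FemtoTransferGap.TT

end
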